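import Summits.KontsevichZagierPeriods.Zeta5Search.LaiSweepShard

/-!
# `κ₃` sweep certificate — shard file 007 of 127 (shards 49–55 of 889)

HONEST FRAMING. Systematic search; no irrationality claim unless certified. This file only checks,
by `decide +kernel`, shards 49–55 of the order-cell sweep of the `κ₃` point `(74, 2180, 444; δ74)`
(engine `LaiSweepEngine`, soundness `LaiSweepJump/Free/Eval/Shard/Kappa3`; a shard is `⟨regime, n,
p, q, p', q', Lo, Up⟩`: `n` cells from `p/q` to `p'/q'` with integer rate sums in `[Lo, Up]`, `K =
128`, `D = 2^40`). It draws NO conclusion: only the capstone `LaiKappa3SweepCert`, which needs all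
127 shard files, does. Kernel cost of this file ≈ 560 cells × 0.3 s.
-/

namespace Summit.KontsevichZagierPeriods.Zeta5Search.Sweep

set_option maxHeartbeats 100000000 in
/-- Shard 49: 80 cells of regime A from `35/2522` to `37/2616`.
[cite: Lai2024BallRivoal, §4 Lemma 4.3] -/
theorem shard049 :
    Shard.check 128 (2^40)
      ⟨false, 80, 35, 2522, 37, 2616, 137976620267298, 138038258080411⟩ = true := by
  decide +kernel

set_option maxHeartbeats 100000000 in
/-- Shard 50: 80 cells of regime A from `37/2616` to `37/2572`.
[cite: Lai2024BallRivoal, §4 Lemma 4.3] -/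
theorem shard050 :
    Shard.check 128 (2^40)
      ⟨false, 80, 37, 2616, 37, 2572, 126964180168392, 127020290590252⟩ = true := by
  decide +kernel

set_option maxHeartbeats 100000000 in
/-- Shard 51: 80 cells of regime A from `37/2572` to `2/137`.
[cite: Lai2024BallRivoal, §4 Lemma 4.3] -/
theorem shard051 :
    Shard.check 128 (2^40)
      ⟨false, 80, 37, 2572, 2, 137, 107861453443701, 107900072772891⟩ = true := by
  decide +kernel

set_option maxHeartbeats 100000000 in
/-- Shard 52: 80 cells of regime A from `2/137` to `11/740`.
[cite: Lai2024BallRivoal, §4 Lemma 4.3] -/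
theorem shard052 :
    Shard.check 128 (2^40)
      ⟨false, 80, 2, 137, 11, 740, 129784149121882, 129843302036787⟩ = true := by
  decide +kernel

set_option maxHeartbeats 100000000 in
/-- Shard 53: 80 cells of regime A from `11/740` to `33/2192`.
[cite: Lai2024BallRivoal, §4 Lemma 4.3] -/
theorem shard053 :
    Shard.check 128 (2^40)
      ⟨false, 80, 11, 740, 33, 2192, 87838683732604, 87866247333961⟩ = true := by
  decide +kernel

set_option maxHeartbeats 100000000 in
/-- Shard 54: 80 cells of regime A from `33/2192` to `39/2546`.
[cite: Lai2024BallRivoal, §4 Lemma 4.3] -/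
theorem shard054 :
    Shard.check 128 (2^40)
      ⟨false, 80, 33, 2192, 39, 2546, 116937396759804, 116987137324733⟩ = true := by
  decide +kernel

set_option maxHeartbeats 100000000 in
/-- Shard 55: 80 cells of regime A from `39/2546` to `3/193`.
[cite: Lai2024BallRivoal, §4 Lemma 4.3] -/
theorem shard055 :
    Shard.check 128 (2^40)
      ⟨false, 80, 39, 2546, 3, 193, 97172066083127, 97205695281471⟩ = true := by
  decide +kernel

/-- The checked shards of this file, in order. [folklore] -/
def shards007 : List (CheckedShard 128 (2^40)) :=
  [⟨_, shard049⟩, ⟨_, shard050⟩, ⟨_, shard051⟩, ⟨_, shard052⟩, ⟨_, shard053⟩,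
    ⟨_, shard054⟩, ⟨_, shard055⟩]

end Summit.KontsevichZagierPeriods.Zeta5Search.Sweep
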